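import Mathlib
import HarnessLib
import Literature.Computability.AlgebraicComplexity.SymmetricOrbitCircuitEval
import Summits.ValiantsHypothesis.ValiantsHypothesis.Theorems.MonotoneRestorationOrbitRestorationQPSmlAffineRestoration
import Summits.ValiantsHypothesis.ValiantsHypothesis.Theorems.MonotoneRestorationOrbitRestorationQPCircuitOfEquivariantTerms

/-!
# The affine set-multilinear stratum in SIZE currency: square-symmetric circuits of quasi-polynomial SIZE
(route MonotoneRestoration; cruxes `NonnegRestorationQP` stmt-ValiantsHypothesis-16191 and `MonotoneRestorationQP`
stmt-ValiantsHypothesis-15886, whose conclusions bound the SIZE `Fintype.card G` of a square-symmetric circuit; also the orbit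
crux `OrbitRestorationQP` stmt-ValiantsHypothesis-18293)

The affine equivariant normal form of `…SmlAffineRestoration.lean`,
`f n = Σ_{β,τ,g} d_{β,τ} · Π_b (β + C_b + Σ_i τ_i x_{(g i,b)})`, is an `S_n`-stable multiset of POLYNOMIALLY many products of
affine forms, so the route-independent term-circuit construction (`eqvTerms_symmetric_size`) yields square-symmetric circuits of
quasi-polynomial (indeed polynomial) SIZE — not merely orbit size.  Hence the set-multilinear stratum holds in the currency of
the size cruxes as well:

* `circuitOfEquivariantTerms_size` — SIZE form of the landed stub B: an equivariant family of term multisets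
  (`IsEquivariantTerms n c (T n)` for all `n`) is computed by square-symmetric circuits with `Fintype.card G ≤ 2^((log₂ n + c')^c')`;
* `affineColSml_symmetricSize` — **every matrix-symmetric family over `ℂ` with affine column-set-multilinear `ΣΠΣ` circuits of
  at most `n^c + c` product gates has square-symmetric circuits of SIZE `≤ 2^((log₂ n + c')^c')`** (levels below the threshold
  by the brute-force orbit circuit `OrbitCircuit.exists_symmetric_circuit_of_invariant`, finitely many);
* `nonneg_affineColSml_symmetricSize` — the same in the exact shape of the conclusion of `NonnegRestorationQP` /
  `MonotoneRestorationQP`: for a matrix-symmetric family `h n ∈ ℝ≥0[x_ij]` whose complexification has affine column-sml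
  circuits of at most `n^c + c` product gates, `∃ c, ∀ n, ∃ G C, C.IsSymmetric ∧ C.eval (C.output ()) = map (h n) ∧ card G ≤
  2^((log₂ n + c)^c)`.

Honest label: a stratum of the three cruxes' CONCLUSIONS on an explicit circuit class (it does not use the `VP` / monotone-complexity
hypotheses); no registered stub is closed; VP ≠ VNP untouched. [folklore]
-/

noncomputable section

open scoped Classical

-- `Summit.ValiantsHypothesis.ValiantsHypothesis.…` is the tree's single-conjunct layout (Sub = Summit).
set_option linter.dupNamespace false

namespace Summit.ValiantsHypothesis.ValiantsHypothesis.Theorems.SmlAffineRestoration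

open MvPolynomial Finset Equiv Literature.Computability.AlgebraicComplexity OrbitRestorationQPDepthThreeRung SmlNumeric
  SmlEquivariantForm SmlRestoration SmlAffineNarrow

/-! ### Stub B in SIZE currency -/

/-- **SIZE form of stub B.**  An equivariant family of term multisets is computed by square-symmetric circuits of quasi-polynomial
SIZE. [folklore] -/
theorem circuitOfEquivariantTerms_size
    (T : (n : ℕ) → Multiset (Multiset (MvPolynomial (Fin n × Fin n) ℂ))) (c : ℕ) (hT : ∀ n : ℕ, IsEquivariantTerms n c (T n)) :
    ∃ c' : ℕ, ∀ n : ℕ, ∃ (G : Type) (_ : Fintype G) (C : LabelledArithCircuit ℂ (Fin n × Fin n) Unit G),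
      C.IsSymmetric (Equiv.Perm (Fin n)) ∧ C.eval (C.output ()) = ((T n).map Multiset.prod).sum ∧
      Fintype.card G ≤ 2 ^ ((Nat.log 2 n + c') ^ c') := by
  obtain ⟨c₃, hc₃⟩ := zeta_poly_mul_qp_le 25 2 c 4
  refine ⟨c₃, fun n => ?_⟩
  have hone : ∀ m : ℕ, 1 ≤ 2 ^ ((Nat.log 2 m + c₃) ^ c₃) := fun _ => Nat.one_le_two_pow
  rcases Nat.eq_zero_or_pos n with rfl | hn
  · obtain ⟨G, inst, C, hC, hev, hcard⟩ := zeta_symmetric_constant (X := Fin 0 × Fin 0)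
      (Γ := Equiv.Perm (Fin 0)) (MvPolynomial.coeff 0 (((T 0).map Multiset.prod).sum))
    refine ⟨G, inst, C, hC, ?_, hcard.trans (hone 0)⟩
    rw [hev]
    exact (MvPolynomial.eq_C_of_isEmpty _).symm
  · haveI : NeZero n := ⟨by omega⟩
    by_cases hT0 : T n = 0
    · obtain ⟨G, inst, C, hC, hev, hcard⟩ := zeta_symmetric_constant (X := Fin n × Fin n)
        (Γ := Equiv.Perm (Fin n)) (0 : ℂ)
      refine ⟨G, inst, C, hC, ?_, hcard.trans (hone n)⟩
      rw [hev, hT0, Multiset.map_zero, Multiset.sum_zero, map_zero]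
    · obtain ⟨h1, h2, h3, h4⟩ := hT n
      obtain ⟨G, inst, C, hC, hev, hcard⟩ :=
        eqvTerms_symmetric_size (2 ^ ((Nat.log 2 n + c) ^ c)) (T n) hT0 h1 h2 h3 h4
      refine ⟨G, inst, C, hC, hev, hcard.trans ?_⟩
      refine (eqvTerms_size_arith n _ Nat.one_le_two_pow).trans ?_
      rw [← pow_mul, mul_comm ((Nat.log 2 n + c) ^ c) 4]
      exact hc₃ n

/-! ### The affine equivariant term multisets of a matrix-symmetric affine column-sml family -/

/-- **Equivariant term multisets from affine column-sml circuits.**  A matrix-symmetric family with affine column-sml circuits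
of at most `n^c + c` product gates agrees, from some level `N₁` on, with the value of an equivariant family of term multisets
(constant `2(c+2)+2`). [folklore] -/
theorem exists_equivariantTerms_affineColSml (f : (n : ℕ) → MvPolynomial (Fin n × Fin n) ℂ) (hsym : IsMatrixSymmetric f)
    {c : ℕ} (hcirc : ∀ n : ℕ, ∃ (s : ℕ) (β : Fin s → Fin n → ℂ) (α : Fin s → Fin n → Fin n → ℂ), s ≤ n ^ c + c ∧
      f n = ∑ t : Fin s, ∏ b : Fin n, (C (β t b) + ∑ a : Fin n, C (α t b a) * X (a, b))) :
    ∃ (N₁ : ℕ) (T : (n : ℕ) → Multiset (Multiset (MvPolynomial (Fin n × Fin n) ℂ))),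
      (∀ n, IsEquivariantTerms n (2 * (c + 2) + 2) (T n)) ∧ ∀ n, N₁ ≤ n → ((T n).map Multiset.prod).sum = f n := by
  classical
  obtain ⟨N₀, hN₀⟩ := exists_pow_add_lt_choose c
  set N₁ := max N₀ (2 * c + 4) with hN₁
  have hform : ∀ n, N₁ ≤ n → ∃ d : Fin (n + 1) × (Fin (c + 1) → Fin (n + 1)) → ℂ,
      f n = ∑ βτg : (Fin (n + 1) × (Fin (c + 1) → Fin (n + 1))) × (Fin (c + 1) → Fin n), C (d βτg.1) *
        ∏ b : Fin n, (C ((βτg.1.1 : ℕ) : ℂ) +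
          ∑ a : Fin n, C (1 + ∑ i : Fin (c + 1), if βτg.2 i = a then ((βτg.1.2 i : ℕ) : ℂ) else 0) * X (a, b)) := by
    intro n hn
    obtain ⟨s, β, α, hs, hf⟩ := hcirc n
    have hrow : ∀ σ : Equiv.Perm (Fin n), rename (fun v : Fin n × Fin n => (σ v.1, v.2))
        (∑ t : Fin s, ∏ b : Fin n, (C (β t b) + ∑ a : Fin n, C (α t b a) * X (a, b)) :
          MvPolynomial (Fin n × Fin n) ℂ) =
        ∑ t : Fin s, ∏ b : Fin n, (C (β t b) + ∑ a : Fin n, C (α t b a) * X (a, b)) := by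
      intro σ; rw [← hf]; simpa using hsym n σ 1
    have hcol : ∀ τ : Equiv.Perm (Fin n), rename (fun v : Fin n × Fin n => (v.1, τ v.2))
        (∑ t : Fin s, ∏ b : Fin n, (C (β t b) + ∑ a : Fin n, C (α t b a) * X (a, b)) :
          MvPolynomial (Fin n × Fin n) ℂ) =
        ∑ t : Fin s, ∏ b : Fin n, (C (β t b) + ∑ a : Fin n, C (α t b a) * X (a, b)) := by
      intro τ; rw [← hf]; simpa using hsym n 1 τ
    have hlt : s < Nat.choose (n - (c + 1 + 1)) (c + 1 + 1) :=
      lt_of_le_of_lt hs (hN₀ n (le_trans (le_max_left _ _) hn))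
    obtain ⟨d, hd⟩ := exists_equivariant_form_affine (w := c + 1) (by omega) β α hrow hcol hlt
    exact ⟨d, hf.trans hd⟩
  choose d hd using hform
  let T : (n : ℕ) → Multiset (Multiset (MvPolynomial (Fin n × Fin n) ℂ)) := fun n =>
    if h : N₁ ≤ n then
      (Finset.univ : Finset ((Fin (n + 1) × (Fin (c + 1) → Fin (n + 1))) × (Fin (c + 1) → Fin n))).val.map fun βτg =>
        C (d n h βτg.1) ::ₘ (Finset.univ : Finset (Fin n)).val.map fun b =>
          C ((βτg.1.1 : ℕ) : ℂ) +
            ∑ a : Fin n, C (1 + ∑ i : Fin (c + 1), if βτg.2 i = a then ((βτg.1.2 i : ℕ) : ℂ) else 0) * X (a, b)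
    else 0
  refine ⟨N₁, T, fun n => ?_, fun n h => ?_⟩
  · by_cases h : N₁ ≤ n
    · have hbound : (n + 1) ^ (2 * (c + 2)) ≤ 2 ^ ((Nat.log 2 n + (2 * (c + 2) + 2)) ^ (2 * (c + 2) + 2)) :=
        succ_pow_le_qp (c + 2) n
      simp only [T, dif_pos h]
      refine ⟨?_, ?_, ?_, ?_⟩
      · intro m hm ℓ hℓ
        obtain ⟨βτg, _, rfl⟩ := Multiset.mem_map.1 hm
        rcases Multiset.mem_cons.1 hℓ with rfl | hℓ
        · rw [totalDegree_C]; exact Nat.zero_le _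
        · obtain ⟨b, _, rfl⟩ := Multiset.mem_map.1 hℓ
          exact totalDegree_affineGenFactor_le _ _ _ _
      · rw [Multiset.card_map, Finset.card_val, Finset.card_univ, Fintype.card_prod, Fintype.card_prod, Fintype.card_fun,
          Fintype.card_fun, Fintype.card_fin, Fintype.card_fin, Fintype.card_fin]
        refine le_trans ?_ hbound
        calc (n + 1) * (n + 1) ^ (c + 1) * n ^ (c + 1) ≤ (n + 1) * (n + 1) ^ (c + 1) * (n + 1) ^ (c + 1) :=
              Nat.mul_le_mul_left _ (Nat.pow_le_pow_left (by omega) _)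
          _ = (n + 1) ^ (2 * c + 3) := by rw [← pow_succ', ← pow_add]; ring_nf
          _ ≤ (n + 1) ^ (2 * (c + 2)) := Nat.pow_le_pow_right (by omega) (by omega)
      · intro m hm
        obtain ⟨βτg, _, rfl⟩ := Multiset.mem_map.1 hm
        rw [Multiset.card_cons, Multiset.card_map, Finset.card_val, Finset.card_univ, Fintype.card_fin]
        refine le_trans ?_ hbound
        calc n + 1 = (n + 1) ^ 1 := (pow_one _).symm
          _ ≤ (n + 1) ^ (2 * (c + 2)) := Nat.pow_le_pow_right (by omega) (by omega)
      · intro σ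
        rw [Multiset.map_map]
        have hterm : ∀ βτg : (Fin (n + 1) × (Fin (c + 1) → Fin (n + 1))) × (Fin (c + 1) → Fin n),
            ((Multiset.map fun ℓ => rename (fun pq : Fin n × Fin n => σ • pq) ℓ) ∘ fun βτg =>
              C (d n h βτg.1) ::ₘ (Finset.univ : Finset (Fin n)).val.map fun b =>
                C ((βτg.1.1 : ℕ) : ℂ) +
                  ∑ a : Fin n, C (1 + ∑ i : Fin (c + 1), if βτg.2 i = a then ((βτg.1.2 i : ℕ) : ℂ) else 0) * X (a, b))
                βτg =
            C (d n h βτg.1) ::ₘ (Finset.univ : Finset (Fin n)).val.map fun b =>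
              C ((βτg.1.1 : ℕ) : ℂ) +
                ∑ a : Fin n, C (1 + ∑ i : Fin (c + 1), if σ (βτg.2 i) = a then ((βτg.1.2 i : ℕ) : ℂ) else 0) *
                  X (a, b) := by
          intro βτg
          simp only [Function.comp_apply, Multiset.map_cons, rename_C, Multiset.map_map]
          congr 1
          rw [Multiset.map_congr rfl (fun b _ => rename_diag_affineGenFactor σ βτg.1.1 βτg.1.2 βτg.2 b)]
          exact map_univ_comp_equiv σ (fun b => C ((βτg.1.1 : ℕ) : ℂ) + ∑ a : Fin n,
            C (1 + ∑ i : Fin (c + 1), if σ (βτg.2 i) = a then ((βτg.1.2 i : ℕ) : ℂ) else 0) * X (a, b))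
        rw [Multiset.map_congr rfl (fun βτg _ => hterm βτg)]
        exact map_univ_comp_equiv
          (Equiv.prodCongr (Equiv.refl (Fin (n + 1) × (Fin (c + 1) → Fin (n + 1))))
            (Equiv.arrowCongr (Equiv.refl (Fin (c + 1))) σ))
          (fun βτg : (Fin (n + 1) × (Fin (c + 1) → Fin (n + 1))) × (Fin (c + 1) → Fin n) =>
            C (d n h βτg.1) ::ₘ (Finset.univ : Finset (Fin n)).val.map fun b =>
              C ((βτg.1.1 : ℕ) : ℂ) +
                ∑ a : Fin n, C (1 + ∑ i : Fin (c + 1), if βτg.2 i = a then ((βτg.1.2 i : ℕ) : ℂ) else 0) * X (a, b))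
    · simp only [T, dif_neg h]
      refine ⟨by simp, by simp, by simp, fun σ => by simp⟩
  · simp only [T, dif_pos h, Multiset.map_map]
    rw [hd n h, Finset.sum_eq_multiset_sum]
    refine congrArg _ (Multiset.map_congr rfl fun βτg _ => ?_)
    simp only [Function.comp_apply, Multiset.prod_cons, Finset.prod_eq_multiset_prod]

/-! ### The stratum in SIZE currency -/

/-- **THE AFFINE SET-MULTILINEAR STRATUM IN SIZE CURRENCY.**  A matrix-symmetric family with affine column-set-multilinear `ΣΠΣ`
circuits of at most `n^c + c` product gates has square-symmetric circuits of SIZE `≤ 2^((log₂ n + c')^c')`. [folklore] -/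
theorem affineColSml_symmetricSize :
    ∀ f : (n : ℕ) → MvPolynomial (Fin n × Fin n) ℂ, IsMatrixSymmetric f →
      (∃ c : ℕ, ∀ n : ℕ, ∃ (s : ℕ) (β : Fin s → Fin n → ℂ) (α : Fin s → Fin n → Fin n → ℂ), s ≤ n ^ c + c ∧
        f n = ∑ t : Fin s, ∏ b : Fin n, (C (β t b) + ∑ a : Fin n, C (α t b a) * X (a, b))) →
      ∃ c' : ℕ, ∀ n : ℕ, ∃ (G : Type) (_ : Fintype G) (C : LabelledArithCircuit ℂ (Fin n × Fin n) Unit G),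
        C.IsSymmetric (Equiv.Perm (Fin n)) ∧ C.eval (C.output ()) = f n ∧
        Fintype.card G ≤ 2 ^ ((Nat.log 2 n + c') ^ c') := by
  intro f hsym ⟨c, hcirc⟩
  obtain ⟨N₁, T, hT, hval⟩ := exists_equivariantTerms_affineColSml f hsym hcirc
  obtain ⟨c₁, hc₁⟩ := circuitOfEquivariantTerms_size T _ hT
  -- below the threshold: the brute-force orbit circuit of the invariant polynomial `f n` (finitely many levels)
  have hinv : ∀ (n : ℕ) (σ : Equiv.Perm (Fin n)), rename (fun pq : Fin n × Fin n => σ • pq) (f n) = f n :=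
    fun n σ => hsym n σ σ
  let B : ℕ → ℕ := fun n =>
    n * n + (f n).support.card * (n * n * (f n).totalDegree) + (f n).support.card + (f n).support.card + 1
  refine ⟨max c₁ ((Finset.range N₁).sup B), fun n => ?_⟩
  by_cases h : N₁ ≤ n
  · obtain ⟨G, inst, C, hC, hev, hcard⟩ := hc₁ n
    exact ⟨G, inst, C, hC, by rw [hev, hval n h], hcard.trans (Restorable.bound_mono (le_max_left _ _) _)⟩
  · obtain ⟨G, inst, C, hC, hev, hcard⟩ := OrbitCircuit.exists_symmetric_circuit_of_invariant (f n) (hinv n)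
    refine ⟨G, inst, C, hC, hev, hcard.trans ?_⟩
    have h1 : B n ≤ (Finset.range N₁).sup B := Finset.le_sup (f := B) (Finset.mem_range.2 (by omega))
    calc B n ≤ max c₁ ((Finset.range N₁).sup B) := h1.trans (le_max_right _ _)
      _ ≤ (Nat.log 2 n + max c₁ ((Finset.range N₁).sup B)) ^ (max c₁ ((Finset.range N₁).sup B)) := by
          rcases Nat.eq_zero_or_pos (max c₁ ((Finset.range N₁).sup B)) with h0 | hpos
          · rw [h0]; exact Nat.zero_le _
          · exact (Nat.le_add_left _ _).trans (Nat.le_self_pow hpos.ne' _)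
      _ ≤ 2 ^ ((Nat.log 2 n + max c₁ ((Finset.range N₁).sup B)) ^ (max c₁ ((Finset.range N₁).sup B))) :=
          Nat.lt_two_pow_self.le

/-- **The stratum in the exact shape of the conclusion of `NonnegRestorationQP` / `MonotoneRestorationQP`.**  For a
matrix-symmetric family `h n ∈ ℝ≥0[x_ij]` whose complexification `map (h n)` has affine column-set-multilinear `ΣΠΣ` circuits of at
most `n^c + c` product gates, there are square-symmetric circuits over `ℂ` computing `map (h n)` of SIZE `≤ 2^((log₂ n + c')^c')`.
[folklore] -/
theorem nonneg_affineColSml_symmetricSize (h : (n : ℕ) → MvPolynomial (Fin n × Fin n) NNReal)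
    (hsym : ∀ (n : ℕ) (σ τ : Equiv.Perm (Fin n)),
      MvPolynomial.rename (fun p : Fin n × Fin n => (σ p.1, τ p.2)) (h n) = h n)
    (hcirc : ∃ c : ℕ, ∀ n : ℕ, ∃ (s : ℕ) (β : Fin s → Fin n → ℂ) (α : Fin s → Fin n → Fin n → ℂ), s ≤ n ^ c + c ∧
      MvPolynomial.map (Complex.ofRealHom.comp NNReal.toRealHom) (h n) =
        ∑ t : Fin s, ∏ b : Fin n, (C (β t b) + ∑ a : Fin n, C (α t b a) * X (a, b))) :
    ∃ c : ℕ, ∀ n : ℕ, ∃ (G : Type) (_ : Fintype G) (C : LabelledArithCircuit ℂ (Fin n × Fin n) Unit G),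
      C.IsSymmetric (Equiv.Perm (Fin n)) ∧
      C.eval (C.output ()) = MvPolynomial.map (Complex.ofRealHom.comp NNReal.toRealHom) (h n) ∧
      Fintype.card G ≤ 2 ^ ((Nat.log 2 n + c) ^ c) := by
  have hsymC : IsMatrixSymmetric fun n => MvPolynomial.map (Complex.ofRealHom.comp NNReal.toRealHom) (h n) := by
    intro n σ τ
    simp only [← map_rename, hsym n σ τ]
  exact affineColSml_symmetricSize _ hsymC hcirc

end Summit.ValiantsHypothesis.ValiantsHypothesis.Theorems.SmlAffineRestoration

end
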